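import Literature.AlgebraicGeometry.HodgeTheory.SupportedClassesPrimeDivisorLocal
import Literature.Barriers.HodgeConjecture.IntegralCoefficientsKollarCurves
import Literature.AlgebraicGeometry.Motives.UnramifiedCohomology
import Literature.AlgebraicTopology.SingularHomology.RelativeCochains
import HarnessLib

/-!
# Saturation of `im (H²(X(ℂ);ℤ) → H²((X∖Z)(ℂ);ℤ))` on a smooth projective surface, from the
# topological Thom statement (line `finite-level-bootstrap`, crux `GenericDivisibilityBounded`,
# stmt-HodgeConjecture-18467, stub `stub_surfaceSaturation_of_thomNC`)

For `X` a smooth projective complex surface and `Z ⊊ X` Zariski-closed, the image of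
`H²(X(ℂ); ℤ) → H²((X ∖ Z)(ℂ); ℤ)` is saturated (`k • y` in the image, `k ≥ 1` ⇒ `y` in the image),
GRANTED the topological statement `stub_thomH3TorsionFreeNC` of the line (torsion-freeness of
`H³(W, W ∖ S; ℤ)` for a straightened finite disjoint union `S` of closed preconnected pieces with
normal coordinates), taken here as a HYPOTHESIS.

Proof. Decompose `Z` into irreducible components (`X` is Noetherian); those whose generic point has
codimension `1` are the curves `C₁, …, C_m`. The bad set `Z₁ ⊆ Z` is the exceptional set of the
straightening of `Z(ℂ)` (`GAGADimension.exists_closed_straightening_off`) together with the points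
of `Z` on no good part `Gᵢ = W_{cᵢ} ∖ ⋃_{D ≠ Cᵢ} D` of a curve (`(W_{cᵢ}, j_{cᵢ})` a local equation
of `Cᵢ` at its generic point, `ComplementDivisor.exists_chart_of_pure`); its points have codimension
`2`, so it is finite (`finite_of_isClosed_of_le_coheight`). In `W = (X ∖ Z₁)(ℂ)` the pieces
`Sᵢ = Cᵢ(ℂ) ∩ W` are closed, preconnected
(`ComplexPoints.isConnected_setOf_pt_mem_inter_of_isIrreducible`), pairwise disjoint, straightened,
with union `Z(ℂ) ∩ W`, and `j_{cᵢ}` is a normal coordinate of `Sᵢ`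
(`exists_normalCoordinate_of_chart`): `H³(W, W ∖ S; ℤ)` is torsion-free by the hypothesis. Finally
`H²(X(ℂ); ℤ) → H²(W; ℤ)` is onto (`restrictComplInt_bijective_of_finite`), `W ∖ S ≃ₜ (X ∖ Z)(ℂ)`,
and in the exact sequence `H²(W) → H²(W ∖ S) —δ→ H³(W, W ∖ S)` (`relSingularCohomology.exact_map_δ`)
a class `y` with `k • y` global has `k • δ y = 0`, so `δ y = 0` and `y` comes from `H²(X(ℂ))`.

References: [VoisinHodgeI2002] §11.1.2; [Fulton1998] §19.1; [HatcherAT2002] §3.1 p. 200;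
[Hartshorne1977] I Prop. 1.5, II Ex. 3.20 (d); [GortzWedhorn2023] Lemma 25.150.
-/

set_option linter.dupNamespace false

noncomputable section

open CategoryTheory AlgebraicGeometry Set TopologicalSpace
open Literature.AlgebraicGeometry.Motives Literature.AlgebraicGeometry.HodgeTheory
  Literature.AlgebraicTopology.SingularHomology Literature.Barriers.HodgeConjecture

namespace Summit.HodgeConjecture.HodgeConjecture.Theorems

/-- **Transport through the exact sequence of the pair.** For `Z₁ ⊆ Z ⊆ X`, `W = (X ∖ Z₁)(ℂ)` and
`A = {Q ∈ W | Q ∉ Z(ℂ)} ≃ₜ (X ∖ Z)(ℂ)`: if `H²(X(ℂ); ℤ) → H²(W; ℤ)` is onto and `H³(W, A; ℤ)` is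
torsion-free, the image of `H²(X(ℂ); ℤ) → H²((X ∖ Z)(ℂ); ℤ)` is saturated — for `k • y = w|`,
`k • δ y = δ (w|_A) = 0`, so `δ y = 0` and `y ∈ im (H²(W) → H²(A)) = ker δ` (exactness of
`H²(W) → H²(A) —δ→ H³(W, A)`, Hatcher §3.1 p. 200), and `H²(W) = H²(X(ℂ))`.
[cite: HatcherAT2002, §3.1 p. 200] -/
theorem surfaceSaturation_transport {X : SchemeOver ℂ} {Z Z₁ : Set X.left} (hZ₁Z : Z₁ ⊆ Z)
    (hsurj : Function.Surjective (singularCohomology.map ℤ ℤ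
      (⟨Subtype.val, continuous_subtype_val⟩ : C(complexPointsCompl X Z₁, ComplexPoints X)) 2))
    (htf : ∀ (c : relSingularCohomology ℤ ℤ (complexPointsCompl X Z₁)
      {Q : complexPointsCompl X Z₁ | Q.1.pt ∉ Z} 3) (k : ℕ), 1 ≤ k → k • c = 0 → c = 0)
    (y : singularCohomology ℤ ℤ (complexPointsCompl X Z) 2) (k : ℕ) (hk : 1 ≤ k)
    (hy : ∃ w : singularCohomology ℤ ℤ (ComplexPoints X) 2, singularCohomology.map ℤ ℤ
      (⟨Subtype.val, continuous_subtype_val⟩ : C(complexPointsCompl X Z, ComplexPoints X)) 2 w =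
        k • y) :
    ∃ w : singularCohomology ℤ ℤ (ComplexPoints X) 2, singularCohomology.map ℤ ℤ
      (⟨Subtype.val, continuous_subtype_val⟩ : C(complexPointsCompl X Z, ComplexPoints X)) 2 w =
        y := by
  set A : Set (complexPointsCompl X Z₁) := {Q | Q.1.pt ∉ Z} with hAdef
  let g : ↥A ≃ₜ complexPointsCompl X Z :=
    { toFun := fun Q ↦ ⟨Q.1.1, Q.2⟩
      invFun := fun P ↦ ⟨⟨P.1, fun h ↦ P.2 (hZ₁Z h)⟩, P.2⟩
      left_inv := fun _ ↦ rfl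
      right_inv := fun _ ↦ rfl
      continuous_toFun := by fun_prop
      continuous_invFun := by fun_prop }
  have hfac : (⟨Subtype.val, continuous_subtype_val⟩ :
      C(complexPointsCompl X Z, ComplexPoints X)).comp (g : C(↥A, complexPointsCompl X Z)) =
      (⟨Subtype.val, continuous_subtype_val⟩ :
        C(complexPointsCompl X Z₁, ComplexPoints X)).comp (subsetIncl A) :=
    ContinuousMap.ext fun _ ↦ rfl
  have hginj : Function.Injective
      (singularCohomology.map ℤ ℤ (g : C(↥A, complexPointsCompl X Z)) 2) :=
    ((forget (ModuleCat ℤ)).mapIso (singularCohomology.mapIso ℤ ℤ g 2)).toEquiv.injective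
  obtain ⟨w, hw⟩ := hy
  -- `k • (g^* y) = (w|_W)|_A`, so `δ (g^* y) = 0` and `g^* y` comes from `H²(W)`
  set y' := singularCohomology.map ℤ ℤ (g : C(↥A, complexPointsCompl X Z)) 2 y with hy'
  have h1 : singularCohomology.map ℤ ℤ (subsetIncl A) 2 (singularCohomology.map ℤ ℤ
      (⟨Subtype.val, continuous_subtype_val⟩ : C(complexPointsCompl X Z₁, ComplexPoints X)) 2 w) =
      k • y' := by
    rw [← ModuleCat.comp_apply, ← singularCohomology.map_comp, ← hfac,
      singularCohomology.map_comp, ModuleCat.comp_apply, hw, map_nsmul]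
  have hex := relSingularCohomology.exact_map_δ (R := ℤ) (M := ℤ) (X := complexPointsCompl X Z₁)
    A 2 3 rfl
  have h0 : singularCohomology.map ℤ ℤ (subsetIncl A) 2 ≫
      relSingularCohomology.δ ℤ ℤ (complexPointsCompl X Z₁) A 2 3 rfl = 0 :=
    (relShortComplex_shortExact ℤ ℤ A).comp_δ 2 3 rfl
  have hδ : relSingularCohomology.δ ℤ ℤ (complexPointsCompl X Z₁) A 2 3 rfl (k • y') = 0 := by
    rw [← h1, ← ModuleCat.comp_apply, h0]
    rfl
  rw [map_nsmul] at hδ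
  rw [ShortComplex.moduleCat_exact_iff] at hex
  obtain ⟨u, hu⟩ := hex y' (htf _ k hk hδ)
  obtain ⟨w', rfl⟩ := hsurj u
  refine ⟨w', hginj ?_⟩
  rw [← ModuleCat.comp_apply, ← singularCohomology.map_comp, hfac, singularCohomology.map_comp,
    ModuleCat.comp_apply]
  exact hu

/-- In `ℕ∞`, `1 ≤ x ≠ 1` forces `2 ≤ x`. [folklore] -/
theorem surfaceSaturation_enat_two_le_of_ne_one {x : ℕ∞} (h1 : ((1 : ℕ) : ℕ∞) ≤ x) (h2 : x ≠ 1) :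
    ((2 : ℕ) : ℕ∞) ≤ x := by
  induction x using ENat.recTopCoe with
  | top => exact le_top
  | coe n =>
    have h1' : 1 ≤ n := by exact_mod_cast h1
    have h2' : n ≠ 1 := fun h ↦ h2 (by rw [h]; rfl)
    have h3 : 2 ≤ n := by omega
    exact_mod_cast h3

/-- In `ℕ∞`, `1 + 1 ≤ y` gives `2 ≤ y`. [folklore] -/
theorem surfaceSaturation_enat_two_le_of_add_one_le {x y : ℕ∞} (h : x + 1 ≤ y) (hx : x = 1) :
    ((2 : ℕ) : ℕ∞) ≤ y := by
  subst hx
  induction y using ENat.recTopCoe with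
  | top => exact le_top
  | coe n =>
    have h' : 1 + 1 ≤ n := by exact_mod_cast h
    exact_mod_cast h'

/-- **Registered stub `stub_surfaceSaturation_of_thomNC` of the line `finite-level-bootstrap`
(geometry-to-topology glue for the surface case).** The topological torsion-freeness of
`H³(W, W ∖ S; ℤ)` at straightened closed subsets with normal coordinates implies SATURATION of
`im (H²(X(ℂ);ℤ) → H²((X∖Z)(ℂ);ℤ))` for `X` a smooth projective complex surface and `Z ⊊ X`
Zariski-closed (module docstring: curve configuration of `Z` off a finite set `Z₁` of closed points,
the pieces `Cᵢ(ℂ) ∩ (X ∖ Z₁)(ℂ)` satisfy the Thom hypotheses, punctures do not change `H²`, exact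
sequence of the pair). [cite: VoisinHodgeI2002, §11.1.2 Lemma 11.13]
[cite: Hartshorne1977, I Prop. 1.5 and II Ex. 3.20 (d)]
[cite: GortzWedhorn2023, Lemma 25.150 (p. 670)] [cite: HatcherAT2002, §3.1 p. 200 and §3.3 p. 231] -/
theorem stub_surfaceSaturation_of_thomNC :
    (∀ {W : Type} [TopologicalSpace W] [SecondCountableTopology W] [T2Space W]
      {m : ℕ} (S : Fin m → Set W),
      (∀ i, IsClosed (S i)) → (∀ i, IsPreconnected (S i)) →
      (∀ i j, i ≠ j → Disjoint (S i) (S j)) →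
      (∀ x ∈ ⋃ i, S i, ∃ (F : Type) (_ : NormedAddCommGroup F) (_ : NormedSpace ℝ F)
          (_ : FiniteDimensional ℝ F) (K : Type) (_ : NormedAddCommGroup K) (_ : NormedSpace ℝ K)
          (e : OpenPartialHomeomorph W (F × K)),
          2 ≤ Module.finrank ℝ F ∧ x ∈ e.source ∧ ∀ z ∈ e.source, z ∈ (⋃ i, S i) ↔ (e z).1 = 0) →
      (∀ i, ∃ (N : Set W) (Φ c : W → ℂ) (K₀ : Type) (_ : NormedAddCommGroup K₀) (_ : NormedSpace ℝ K₀)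
          (e₀ : OpenPartialHomeomorph W (ℂ × K₀)) (s₀ : W),
          IsOpen N ∧ S i ⊆ N ∧ ContinuousOn Φ N ∧ (∀ z ∈ N, Φ z = 0 → z ∈ S i) ∧
          (∀ z ∈ e₀.source, z ∈ S i ↔ (e₀ z).1 = 0) ∧ s₀ ∈ e₀.source ∧ s₀ ∈ S i ∧
          ContinuousOn c e₀.source ∧ (∀ z ∈ e₀.source, c z ≠ 0) ∧
          ∀ z ∈ e₀.source, Φ z = c z * (e₀ z).1) →
      ∀ (c : relSingularCohomology ℤ ℤ W (⋃ i, S i)ᶜ 3) (k : ℕ), 1 ≤ k → k • c = 0 → c = 0) →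
    ∀ ⦃X : SchemeOver ℂ⦄, IsSmoothProjective (2 * 1) X → ∀ (Z : Set X.left), IsClosed Z →
      Z ≠ Set.univ → ∀ (y : singularCohomology ℤ ℤ (complexPointsCompl X Z) (2 * 1)) (k : ℕ),
        1 ≤ k →
        (∃ w : singularCohomology ℤ ℤ (ComplexPoints X) (2 * 1),
          singularCohomology.map ℤ ℤ
            (⟨Subtype.val, continuous_subtype_val⟩ : C(complexPointsCompl X Z, ComplexPoints X))
            (2 * 1) w = k • y) →
        ∃ w : singularCohomology ℤ ℤ (ComplexPoints X) (2 * 1),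
          singularCohomology.map ℤ ℤ
            (⟨Subtype.val, continuous_subtype_val⟩ : C(complexPointsCompl X Z, ComplexPoints X))
            (2 * 1) w = y := by
  intro hThom X hX' Z hZ hZne y k hk hy
  classical
  have hX : IsSmoothProjective 2 X := hX'
  -- instances on `X` and `X(ℂ)`
  haveI : IsIntegral X.left := IsSmoothProjective.isIntegral_holds hX
  haveI := hX.smoothOfRelativeDimension
  haveI : LocallyOfFiniteType X.hom := by
    haveI : Smooth X.hom := SmoothOfRelativeDimension.smooth 2 _
    infer_instance
  haveI : IsLocallyNoetherian X.left := IsSmoothProjective.isLocallyNoetherian_holds hX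
  haveI : CompactSpace X.left := IsSmoothProjective.compactSpace_holds hX
  haveI : IsNoetherian X.left := {}
  haveI : SecondCountableTopology (ComplexPoints X) :=
    ComplexPoints.secondCountableTopology_of_compactSpace_holds X
  haveI : T2Space (ComplexPoints X) := ComplexPoints.t2Space_of_isSmoothProjective hX
  -- every point of the proper closed `Z` has codimension `≥ 1`
  have hZ1 : ∀ z ∈ Z, ((1 : ℕ) : ℕ∞) ≤ Order.coheight z := fun z hz ↦
    one_le_coheight_of_mem_of_ne_univ hZ hZne hz
  -- the irreducible components of `Z` and their generic points
  obtain ⟨𝒮, h𝒮f, h𝒮c, h𝒮i, hZ𝒮⟩ :=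
    TopologicalSpace.NoetherianSpace.exists_finite_set_isClosed_irreducible hZ
  have hsub : ∀ D ∈ 𝒮, D ⊆ Z := fun D hD z hz ↦ by
    rw [hZ𝒮]
    exact Set.mem_sUnion.2 ⟨D, hD, hz⟩
  have hcov : ∀ z ∈ Z, ∃ D ∈ 𝒮, z ∈ D := fun z hz ↦ by
    rw [hZ𝒮] at hz
    exact Set.mem_sUnion.1 hz
  have hgen : ∀ D (hD : D ∈ 𝒮), IsGenericPoint (h𝒮i D hD).genericPoint D := fun D hD ↦
    (h𝒮i D hD).isGenericPoint_genericPoint (h𝒮c D hD)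
  -- the curves among them (generic point of codimension `1`), enumerated by `Fin m`
  haveI : Finite ↥𝒮 := h𝒮f.to_subtype
  let ι := {D : Set X.left // ∃ hD : D ∈ 𝒮, Order.coheight (h𝒮i D hD).genericPoint = 1}
  haveI : Finite ι := Finite.of_injective (fun D : ι ↦ (⟨D.1, D.2.1⟩ : ↥𝒮))
    fun a b h ↦ Subtype.ext (by have h' := congrArg Subtype.val h; exact h')
  obtain ⟨m, ⟨σ⟩⟩ := Finite.exists_equiv_fin ι
  let C : Fin m → Set X.left := fun i ↦ (σ.symm i).1
  have hC𝒮 : ∀ i, C i ∈ 𝒮 := fun i ↦ (σ.symm i).2.1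
  have hCc : ∀ i, IsClosed (C i) := fun i ↦ h𝒮c _ (hC𝒮 i)
  have hCi : ∀ i, IsIrreducible (C i) := fun i ↦ h𝒮i _ (hC𝒮 i)
  have hCη : ∀ i, Order.coheight (hCi i).genericPoint = 1 := fun i ↦ (σ.symm i).2.2
  have hCinj : ∀ i j, C i = C j → i = j := fun i j h ↦ σ.symm.injective (Subtype.ext h)
  have hCsurj : ∀ D (hD : D ∈ 𝒮), Order.coheight (h𝒮i D hD).genericPoint = 1 → ∃ i, C i = D :=
    fun D hD h ↦ ⟨σ ⟨D, hD, h⟩, by simp only [C, Equiv.symm_apply_apply]⟩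
  -- a local equation `(W_{cᵢ}, j_{cᵢ})` of each curve at its generic point: `X` is locally
  -- factorial (Matsumura Thm. 20.3) and `Cᵢ` is pure of codimension one on affine charts
  have hUFD : ∀ x : X.left, UniqueFactorizationMonoid (X.left.presheaf.stalk x) := fun x ↦
    Literature.AlgebraicGeometry.Resolution.Matsumura1987_20_3_holds _
      (isRegularLocalRing_stalk_of_smoothOfRelativeDimension X.hom 2 x)
  obtain ⟨z₀, hz₀⟩ := (Set.ne_univ_iff_exists_notMem Z).1 hZne
  have hch : ∀ i, ∃ c : ComplementDivisor.Chart (⟨(C i)ᶜ, (hCc i).isOpen_compl⟩ : X.left.Opens),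
      (hCi i).genericPoint ∈ c.W := fun i ↦ by
    set UW : X.left.Opens := ⟨(C i)ᶜ, (hCc i).isOpen_compl⟩ with hUW
    haveI : Nonempty UW := ⟨⟨z₀, fun h ↦ hz₀ (hsub _ (hC𝒮 i) h)⟩⟩
    have hcompl : UW.compl = ⟨C i, hCc i⟩ := by
      ext x
      change x ∈ ((C i)ᶜ)ᶜ ↔ x ∈ C i
      rw [compl_compl]
    refine ComplementDivisor.exists_chart_of_pure hUFD (fun V hV _ P hP ↦ ?_) _
    rw [hcompl] at hP
    exact height_eq_one_of_mem_minimalPrimes_of_isGenericPoint (hCc i)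
      ((hCi i).isGenericPoint_genericPoint (hCc i)) (hCη i) V hV P hP
  choose ch hch using hch
  -- the good open part of each curve: inside its chart and off the other components
  let G : Fin m → Set X.left := fun i ↦
    {z | z ∈ ((ch i).W : Set X.left) ∧ ∀ D ∈ 𝒮, z ∈ D → D = C i}
  have hGo : ∀ i, IsOpen (G i) := fun i ↦ by
    have hGeq : G i = ((ch i).W : Set X.left) ∩ ⋂ D ∈ 𝒮, (Dᶜ ∪ {_z | D = C i}) := by
      ext z
      simp only [G, Set.mem_setOf_eq, Set.mem_inter_iff, Set.mem_iInter, Set.mem_union,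
        Set.mem_compl_iff, imp_iff_not_or]
    rw [hGeq]
    exact (ch i).W.isOpen.inter
      (h𝒮f.isOpen_biInter fun D hD ↦ (h𝒮c D hD).isOpen_compl.union isOpen_const)
  -- the generic point of a curve lies on no other component
  have hηG : ∀ i, (hCi i).genericPoint ∈ G i := by
    intro i
    refine ⟨hch i, fun D hD hηD ↦ ?_⟩
    by_contra hne
    have hle : (hCi i).genericPoint ≤ (h𝒮i D hD).genericPoint :=
      Scheme.le_iff_specializes.2 ((hgen D hD).specializes hηD)
    have hne' : (hCi i).genericPoint ≠ (h𝒮i D hD).genericPoint := by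
      intro h
      apply hne
      rw [← (hgen D hD).def, ← (hgen _ (hC𝒮 i)).def, h]
    have hlt : (hCi i).genericPoint < (h𝒮i D hD).genericPoint :=
      lt_of_le_not_ge hle fun hge ↦ hne'
        ((Scheme.le_iff_specializes.1 hge).antisymm (Scheme.le_iff_specializes.1 hle)).eq
    have h1 := (add_le_add (hZ1 _ (hsub D hD (hgen D hD).mem)) (le_refl (1 : ℕ∞))).trans
      (Order.coheight_add_one_le hlt)
    rw [hCη i, Nat.cast_one] at h1
    have h2 := surfaceSaturation_enat_two_le_of_add_one_le h1 rfl
    exact absurd (by exact_mod_cast h2 : (2 : ℕ) ≤ 1) (by omega)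
  -- the straightening of `Z(ℂ)` off a closed `Z₀ ⊆ Z` of codimension `≥ 2`, and the bad set `Z₁`
  obtain ⟨Z₀, hZ₀, hZ₀Z, hcZ₀, hstr⟩ := GAGADimension.exists_closed_straightening_off hX hZ hZ1
  set Z₁ : Set X.left := Z₀ ∪ (Z ∩ (⋃ i, G i)ᶜ) with hZ₁def
  have hZ₁c : IsClosed Z₁ := hZ₀.union (hZ.inter (isOpen_iUnion hGo).isClosed_compl)
  have hZ₁Z : Z₁ ⊆ Z := Set.union_subset hZ₀Z Set.inter_subset_left
  have hgood : ∀ z ∈ Z, z ∉ Z₁ → ∃ i, z ∈ G i := fun z hz hz₁ ↦ by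
    by_contra h
    exact hz₁ (Or.inr ⟨hz, fun h' ↦ h (Set.mem_iUnion.1 h')⟩)
  -- off `Z₁`, a point of `Z` lying on `Cᵢ` lies in `Gᵢ`
  have hCG : ∀ i, ∀ z ∈ C i, z ∉ Z₁ → z ∈ G i := fun i z hz hz₁ ↦ by
    obtain ⟨l, hl⟩ := hgood z (hsub _ (hC𝒮 i) hz) hz₁
    obtain rfl := hCinj _ _ (hl.2 _ (hC𝒮 i) hz)
    exact hl
  have hcZ₁ : ∀ z ∈ Z₁, ((2 : ℕ) : ℕ∞) ≤ Order.coheight z := by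
    rintro z (hz | ⟨hz, hzG⟩)
    · exact hcZ₀ z hz
    · obtain ⟨D, hD, hzD⟩ := hcov z hz
      have hle : z ≤ (h𝒮i _ hD).genericPoint :=
        Scheme.le_iff_specializes.2 ((hgen _ hD).specializes hzD)
      by_cases hD1 : Order.coheight (h𝒮i D hD).genericPoint = 1
      · obtain ⟨i, rfl⟩ := hCsurj D hD hD1
        have hne : z ≠ (h𝒮i _ hD).genericPoint := by
          rintro rfl
          exact hzG (Set.mem_iUnion.2 ⟨i, hηG i⟩)
        have hlt : z < (h𝒮i _ hD).genericPoint := lt_of_le_not_ge hle fun hge ↦ hne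
          ((Scheme.le_iff_specializes.1 hge).antisymm (Scheme.le_iff_specializes.1 hle)).eq
        exact surfaceSaturation_enat_two_le_of_add_one_le (Order.coheight_add_one_le hlt) (hCη i)
      · exact (surfaceSaturation_enat_two_le_of_ne_one (hZ1 _ (hsub D hD (hgen D hD).mem))
          hD1).trans (Order.coheight_anti hle)
  have hZ₁f : Z₁.Finite := finite_of_isClosed_of_le_coheight hX hZ₁c hcZ₁
  have hηZ₁ : ∀ i, (hCi i).genericPoint ∉ Z₁ := fun i h ↦ by
    have h2 := hcZ₁ _ h
    rw [hCη i] at h2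
    exact absurd (by exact_mod_cast h2 : (2 : ℕ) ≤ 1) (by omega)
  -- `W = (X ∖ Z₁)(ℂ)`: punctures do not change `H²`; reduce to torsion-freeness of `H³(W, W ∖ Z(ℂ))`
  haveI : SecondCountableTopology (complexPointsCompl X Z₁) :=
    inferInstanceAs (SecondCountableTopology ↥{P : ComplexPoints X | P.pt ∉ Z₁})
  haveI : T2Space (complexPointsCompl X Z₁) :=
    inferInstanceAs (T2Space ↥{P : ComplexPoints X | P.pt ∉ Z₁})
  have hO : IsOpen {P : ComplexPoints X | P.pt ∉ Z₁} := isOpen_setOf_pt_not_mem hZ₁c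
  let s : Opens (ComplexPoints X) := ⟨{P | P.pt ∉ Z₁}, hO⟩
  have hbij := restrictComplInt_bijective_of_finite hX (by norm_num) hZ₁f (k := 2) le_rfl
    (by norm_num) (by norm_num)
  refine surfaceSaturation_transport hZ₁Z hbij.2 ?_ y k hk hy
  -- the pieces `Sᵢ = Cᵢ(ℂ) ∩ W` and their union `Z(ℂ) ∩ W`
  let S : Fin m → Set (complexPointsCompl X Z₁) := fun i ↦ {Q | Q.1.pt ∈ C i}
  have hSU : ∀ Q : complexPointsCompl X Z₁, Q ∈ (⋃ i, S i) ↔ Q.1.pt ∈ Z := fun Q ↦ by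
    rw [Set.mem_iUnion]
    refine ⟨fun ⟨i, hi⟩ ↦ hsub _ (hC𝒮 i) hi, fun h ↦ ?_⟩
    obtain ⟨i, hi⟩ := hgood _ h Q.2
    obtain ⟨D, hD, hQD⟩ := hcov _ h
    exact ⟨i, show Q.1.pt ∈ C i from hi.2 D hD hQD ▸ hQD⟩
  have hA : (⋃ i, S i)ᶜ = {Q : complexPointsCompl X Z₁ | Q.1.pt ∉ Z} := by
    ext Q
    rw [Set.mem_compl_iff, hSU]
    rfl
  have key := hThom S
    (fun i ↦ (isClosed_setOf_pt_mem_int (hCc i)).preimage continuous_subtype_val) ?_ ?_ ?_ ?_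
  · rw [hA] at key
    exact key
  · -- preconnected: `Sᵢ` is `(Cᵢ ∖ Z₁)(ℂ)` read in the subspace `W`, and `Cᵢ` is irreducible
    intro i
    have hconn := ComplexPoints.isConnected_setOf_pt_mem_inter_of_isIrreducible X (hCc i) (hCi i)
      ⟨Z₁ᶜ, hZ₁c.isOpen_compl⟩ ⟨_, ((hCi i).isGenericPoint_genericPoint (hCc i)).mem, hηZ₁ i⟩
    have himg : (Subtype.val : complexPointsCompl X Z₁ → ComplexPoints X) '' S i =
        {P : ComplexPoints X | P.pt ∈ C i ∧
          P.pt ∈ ((⟨Z₁ᶜ, hZ₁c.isOpen_compl⟩ : X.left.Opens) : Set X.left)} := by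
      ext P
      constructor
      · rintro ⟨Q, hQ, rfl⟩
        exact ⟨hQ, Q.2⟩
      · rintro ⟨hPC, hPZ⟩
        exact ⟨⟨P, hPZ⟩, hPC, rfl⟩
    have hind : Topology.IsInducing (Subtype.val : complexPointsCompl X Z₁ → ComplexPoints X) :=
      ⟨rfl⟩
    rw [← hind.isPreconnected_image, himg]
    exact hconn.isPreconnected
  · -- pairwise disjoint: off `Z₁` two curves do not meet
    intro i j hij
    exact Set.disjoint_left.2 fun Q hQi hQj ↦
      hij (hCinj i j ((hCG i _ hQi Q.2).2 _ (hC𝒮 j) hQj).symm)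
  · -- straightened, of real codimension `2c' ≥ 2`
    intro x hx
    obtain ⟨c', K, e, hc', hxe, he⟩ := hstr x.1 ((hSU x).1 hx) fun h ↦ x.2 (Or.inl h)
    let e' : OpenPartialHomeomorph (complexPointsCompl X Z₁) ((Fin c' → ℂ) × ↥K) :=
      e.subtypeRestr (s := s) ⟨x⟩
    have he's : e'.source = Subtype.val ⁻¹' e.source :=
      OpenPartialHomeomorph.subtypeRestr_source e ⟨x⟩
    have he'a : ∀ z : complexPointsCompl X Z₁, e' z = e z.1 := fun z ↦ rfl
    refine ⟨Fin c' → ℂ, inferInstance, inferInstance, inferInstance, ↥K, inferInstance,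
      inferInstance, e', ?_, ?_, fun z hz ↦ ?_⟩
    · have hfr : Module.finrank ℝ (Fin c' → ℂ) = 2 * c' := by
        rw [Module.finrank_pi_fintype, Finset.sum_const, Finset.card_univ, Fintype.card_fin,
          Complex.finrank_real_complex, smul_eq_mul, mul_comm]
      rw [hfr]
      omega
    · rw [he's]
      exact hxe
    · rw [he's] at hz
      rw [he'a, hSU]
      exact he z.1 hz
  · -- the normal coordinate of each piece: the local equation `j_{cᵢ}` near a simple point
    intro i
    obtain ⟨K₀, e₀, s₀, cf, he₀, he₀C, hs₀, hs₀C, hcf, hcf0, hfe⟩ :=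
      exists_normalCoordinate_of_chart hX (hCc i) (hCi i) (hCη i) (ch i) (hch i) hZ₁c hcZ₁
    let y₀ : complexPointsCompl X Z₁ := ⟨s₀, (he₀ hs₀).2⟩
    let e₀' : OpenPartialHomeomorph (complexPointsCompl X Z₁) (ℂ × ↥K₀) :=
      e₀.subtypeRestr (s := s) ⟨y₀⟩
    have he₀'s : e₀'.source = Subtype.val ⁻¹' e₀.source :=
      OpenPartialHomeomorph.subtypeRestr_source e₀ ⟨y₀⟩
    have he₀'a : ∀ z : complexPointsCompl X Z₁, e₀' z = e₀ z.1 := fun z ↦ rfl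
    refine ⟨{Q | Q.1.pt ∈ (ch i).W}, fun Q ↦ AlgPoints.evalOrZero (ch i).W (ch i).j Q.1,
      fun Q ↦ cf Q.1, ↥K₀, inferInstance, inferInstance, e₀', y₀,
      (AlgPoints.isOpen_setOf_pt_mem (X := X) (L := ℂ) (ch i).W).preimage continuous_subtype_val,
      fun Q hQ ↦ (hCG i _ hQ Q.2).1,
      (AlgPoints.continuousOn_evalOrZero (ch i).W (ch i).j).comp
        continuous_subtype_val.continuousOn (fun Q hQ ↦ hQ),
      fun Q hQ h0 ↦ not_not.1 ((evalOrZero_chart_eq_zero_iff (ch i) hQ).1 h0),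
      fun z hz ↦ ?_, ?_, hs₀C, ?_, fun z hz ↦ ?_, fun z hz ↦ ?_⟩
    · rw [he₀'s] at hz
      rw [he₀'a]
      exact he₀C z.1 hz
    · rw [he₀'s]
      exact hs₀
    · exact hcf.comp continuous_subtype_val.continuousOn fun z hz ↦ by rwa [he₀'s] at hz
    · rw [he₀'s] at hz
      exact hcf0 z.1 hz
    · rw [he₀'s] at hz
      rw [he₀'a]
      exact hfe z.1 hz

end Summit.HodgeConjecture.HodgeConjecture.Theorems

end
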